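import Mathlib
import Summits.KontsevichZagierPeriods.Zeta5Search.TS1RayCellsA
import Summits.KontsevichZagierPeriods.Zeta5Search.TS1RayCellsB
import Summits.KontsevichZagierPeriods.Zeta5Search.TS1RayCellsC
import Summits.KontsevichZagierPeriods.Zeta5Search.TS1RayCellsD
import Summits.KontsevichZagierPeriods.Zeta5Search.TS1RayCellsE
import Summits.KontsevichZagierPeriods.Zeta5Search.TS1RayCellsF
import Summits.KontsevichZagierPeriods.Zeta5Search.TS1RayCellsG
import Summits.KontsevichZagierPeriods.Zeta5Search.FlagRayCasLB
import HarnessLib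

/-!
# ζ(5) search — the Casoratian class bound `casLB` on EVERY first-period θ-cell of TOP_STAIR #1 (ray H1), all `n` (part 1: kit + the cells)

Cell `pub-zeta5` (HONEST FRAMING: systematic search; no irrationality claim unless certified), TRACK «DENOM-LAW» D1 prover seat
(denom-prover-d1 g13, `HOME/denom-law/prover-d1/ATTEMPT-13.md`).  TOP_STAIR #1 is the census's T1-map ray H1, `b(n) = n·(34; 14,13,12,11,10,9,8) =
bLin (8n) (6n) n` (direction `a = (7,13,9,12,11,15,17,12)`; `b₀ = 34n`, `d = 25n`; the 28 Brown–Zudilin forms are `< 2p` iff `p > 8.5n` = the first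
period).  The class-type covers `TS1RayCellsA–G` (all `n ≥ 1`, no parity split) give the EXACT value of the tree's Casoratian class bound on each
θ-cell (`θ = p/n`): `casLB ≥ −11, −9, −9, −7, −9, −7, −7, −5, −3, −1, 0, 1, 0` on `(8.5,9], (9,10], (10,11], (11,34/3], (34/3,12], (12,12.5), (12.5,13],
(13,14], (14,15], (15,16], (16,17], (17,25], (25,34]` (all attained: `HOME/…/g13/tables/recon_ts1_n40.txt`), and `casLB ≥ 0` beyond the support (`p > 34n`).
§0 is the ray kit for EVERY contiguity index `j` (the tree's `RayH1Levels` wrappers are `j = 7`): every shift `b(n) + e_j` lies in the polytope, the window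
facts for `p > 8.5n`, THEOREM LB `cas_ge_casLB` (`b₀` as a natural number is the tree's `AtlasRay4.b0_toNat`).  Consumed by `TS1RayDominance` ((CV) for every prime `p > 8.5n`) and `DenomLaw/TS1RayPath`.
MODEL/structure-side integer bookkeeping on the cell's own class data; nothing about ζ(5); no γ; records in print UNMOVED.
-/

open Finset

namespace Summit.KontsevichZagierPeriods.Zeta5Search.StairTS1

open Summit.KontsevichZagierPeriods.Zeta5Search.ClusterValuation
open Summit.KontsevichZagierPeriods.Zeta5Search.CasoratianValuation (InPolytope shift casoratian pairFloors refund)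
open Summit.KontsevichZagierPeriods.Zeta5Search.WedgeDictionary (dOf)
open Summit.KontsevichZagierPeriods.Zeta5Search.ClassTypeCover
open Summit.KontsevichZagierPeriods.Zeta5Search.CellKit (bLin inPolytope_bLin dOf_bLin)
open Summit.KontsevichZagierPeriods.Zeta5Search.StairFLAG (casLB_of_cover')

/-! ## §0 Ray kit (every `j`) -/

/-- `b₀ = 34n`. -/
theorem w0 (n : ℕ) : bLin (8 * n) (6 * n) n 0 = 34 * (n : ℤ) := by simp [bLin]; ring
/-- `b₁ = 14n`. -/
theorem w1 (n : ℕ) : bLin (8 * n) (6 * n) n 1 = 14 * (n : ℤ) := by simp [bLin]; ring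
/-- `b₂ = 13n`. -/
theorem w2 (n : ℕ) : bLin (8 * n) (6 * n) n 2 = 13 * (n : ℤ) := by simp [bLin]; ring
/-- `b₃ = 12n`. -/
theorem w3 (n : ℕ) : bLin (8 * n) (6 * n) n 3 = 12 * (n : ℤ) := by simp [bLin]; ring
/-- `b₄ = 11n`. -/
theorem w4 (n : ℕ) : bLin (8 * n) (6 * n) n 4 = 11 * (n : ℤ) := by simp [bLin]; ring
/-- `b₅ = 10n`. -/
theorem w5 (n : ℕ) : bLin (8 * n) (6 * n) n 5 = 10 * (n : ℤ) := by simp [bLin]; ring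
/-- `b₆ = 9n`. -/
theorem w6 (n : ℕ) : bLin (8 * n) (6 * n) n 6 = 9 * (n : ℤ) := by simp [bLin]; ring
/-- `b₇ = 8n`. -/
theorem w7 (n : ℕ) : bLin (8 * n) (6 * n) n 7 = 8 * (n : ℤ) := by simp [bLin]

/-- `d = 3b₀ − Σ b_i = 25n`. -/
theorem dOf_h1 (n : ℕ) : dOf (bLin (8 * n) (6 * n) n) = 25 * (n : ℤ) := by rw [dOf_bLin]; push_cast; ring

/-- The ray lies in the Brown–Zudilin polytope. -/
theorem inPolytope_h1 (n : ℕ) : InPolytope (bLin (8 * n) (6 * n) n) := inPolytope_bLin (by omega)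

/-- **Every contiguous shift `b(n) + e_j` lies in the polytope** (`n ≥ 1`, `1 ≤ j ≤ 7`). -/
theorem inPolytope_shift_h1_j {n : ℕ} (hn : 1 ≤ n) (j : ℕ) (hj1 : 1 ≤ j) (hj7 : j ≤ 7) :
    InPolytope (shift (bLin (8 * n) (6 * n) n) j) := by
  have hs : ∀ i, shift (bLin (8 * n) (6 * n) n) j i =
      if i = j then bLin (8 * n) (6 * n) n j + 1 else bLin (8 * n) (6 * n) n i := by
    intro i; simp only [shift, Function.update_apply]
  interval_cases j <;>
  · refine ⟨⟨?_, ?_⟩, ?_, ?_⟩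
    · rw [hs]; simp only [Nat.reduceEqDiff, if_false, w0]; positivity
    · intro i hi
      simp only [Finset.mem_range] at hi
      interval_cases i <;> simp only [hs, Nat.reduceAdd, Nat.reduceEqDiff, if_true, if_false, w0, w1, w2, w3, w4, w5, w6, w7] <;> omega
    · intro i hi
      simp only [Finset.mem_range] at hi
      interval_cases i <;> simp only [hs, Nat.reduceAdd, Nat.reduceEqDiff, if_true, if_false, w0, w1, w2, w3, w4, w5, w6, w7] <;> omega
    · simp only [Finset.sum_range_succ, Finset.sum_range_zero, zero_add, Nat.reduceAdd, hs, Nat.reduceEqDiff, if_true, if_false,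
        w0, w1, w2, w3, w4, w5, w6, w7]; omega

/-- Window facts for the first period `17n < 2p` (`n ≥ 1`): `5 ≤ p` and `b₀ + 2 < p²`. -/
theorem window85 {n p : ℕ} (hn : 1 ≤ n) (h : 17 * n < 2 * p) :
    5 ≤ p ∧ (bLin (8 * n) (6 * n) n 0 + 2 : ℤ) < (p : ℤ) ^ 2 := by
  refine ⟨by omega, ?_⟩
  rw [w0]
  have h9 : (17 * n + 1 : ℤ) ≤ 2 * p := by exact_mod_cast (show 17 * n + 1 ≤ 2 * p by omega)
  have hn1 : (1 : ℤ) ≤ n := by exact_mod_cast hn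
  nlinarith

/-- `p ≤ d = 25n`. -/
theorem le_dOf_h1 {n p : ℕ} (h : p ≤ 25 * n) : (p : ℤ) ≤ dOf (bLin (8 * n) (6 * n) n) := by
  rw [dOf_h1]; exact_mod_cast h

/-- `p ≤ b₀ = 34n`. -/
theorem le_b0_h1 {n p : ℕ} (h : p ≤ 34 * n) : (p : ℤ) ≤ bLin (8 * n) (6 * n) n 0 := by
  rw [w0]; exact_mod_cast h

/-- **THEOREM LB on the ray, any direction `j`**: `casLB(b(n),p) ≤ v_p(Cas_j(b(n)))` for `17n < 2p`. -/
theorem cas_ge_casLB {n j p : ℕ} (hn : 1 ≤ n) (hj1 : 1 ≤ j) (hj7 : j ≤ 7) (hprime : p.Prime) (h : 17 * n < 2 * p)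
    (hcas : casoratian (bLin (8 * n) (6 * n) n) j ≠ 0) :
    casLB (bLin (8 * n) (6 * n) n) p ≤ padicValRat p (casoratian (bLin (8 * n) (6 * n) n) j) := by
  obtain ⟨hp5, hwin⟩ := window85 hn h
  exact casoratianClassBound_holds _ j p (inPolytope_h1 n) hj1 hj7 (inPolytope_shift_h1_j hn j hj1 hj7) hprime hp5 hwin hcas

/-! ## §1 `casLB` cell by cell (from the covers; `d = 25n`) -/

section Cells
variable {n p : ℕ} [Fact p.Prime]

/-- `(8.5,9]`: `casLB ≥ −11`. -/
theorem casLB_c8 (hA : 17 * n < 2 * p) (hB : 1 * p ≤ 9 * n) (hp2 : p % 2 = 1) :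
    (-11 : ℤ) ≤ casLB (bLin (8 * n) (6 * n) n) p := by
  rcases casLB_of_cover' (cover_c8 hA hB hp2) (by rw [oddFlag_bH1lin n]; exact checkM_c8) (by norm_num)
    (fun h => absurd h (by rw [dOf_h1]; omega)) with ⟨h0, -⟩ | h
  · rw [h0]; norm_num
  · linarith

/-- `(9,10]`: `casLB ≥ −9`. -/
theorem casLB_c9 (hA : 9 * n < 1 * p) (hB : 1 * p ≤ 10 * n) (hp2 : p % 2 = 1) :
    (-9 : ℤ) ≤ casLB (bLin (8 * n) (6 * n) n) p := by
  rcases casLB_of_cover' (cover_c9 hA hB hp2) (by rw [oddFlag_bH1lin n]; exact checkM_c9) (by norm_num)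
    (fun h => absurd h (by rw [dOf_h1]; omega)) with ⟨h0, -⟩ | h
  · rw [h0]; norm_num
  · linarith

/-- `(10,11]`: `casLB ≥ −9`. -/
theorem casLB_c10 (hA : 10 * n < 1 * p) (hB : 1 * p ≤ 11 * n) (hp2 : p % 2 = 1) :
    (-9 : ℤ) ≤ casLB (bLin (8 * n) (6 * n) n) p := by
  rcases casLB_of_cover' (cover_c10 hA hB hp2) (by rw [oddFlag_bH1lin n]; exact checkM_c10) (by norm_num)
    (fun h => absurd h (by rw [dOf_h1]; omega)) with ⟨h0, -⟩ | h
  · rw [h0]; norm_num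
  · linarith

/-- `(11,34/3]`: `casLB ≥ −7`. -/
theorem casLB_c11a (hA : 11 * n < 1 * p) (hB : 3 * p ≤ 34 * n) (hp2 : p % 2 = 1) :
    (-7 : ℤ) ≤ casLB (bLin (8 * n) (6 * n) n) p := by
  rcases casLB_of_cover' (cover_c11a hA hB hp2) (by rw [oddFlag_bH1lin n]; exact checkM_c11a) (by norm_num)
    (fun h => absurd h (by rw [dOf_h1]; omega)) with ⟨h0, -⟩ | h
  · rw [h0]; norm_num
  · linarith

/-- `(34/3,12]`: `casLB ≥ −9` (`= −7` when `3p = 34n + 1`, `−9` otherwise; the PATH value `−7` needs the double-drop bonus, `TS1RayDominance`). -/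
theorem casLB_c11b (hA : 34 * n < 3 * p) (hB : 1 * p ≤ 12 * n) (hp2 : p % 2 = 1) :
    (-9 : ℤ) ≤ casLB (bLin (8 * n) (6 * n) n) p := by
  rcases casLB_of_cover' (cover_c11b hA hB hp2) (by rw [oddFlag_bH1lin n]; exact checkM_c11b) (by norm_num)
    (fun h => absurd h (by rw [dOf_h1]; omega)) with ⟨h0, -⟩ | h
  · rw [h0]; norm_num
  · linarith

/-- `(12,12.5)`: `casLB ≥ −7` (the PATH value `−6` needs the collinearity rung, `TS1RayDominance`). -/
theorem casLB_c12a (hA : 12 * n < 1 * p) (hB : 2 * p < 25 * n) (hp2 : p % 2 = 1) :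
    (-7 : ℤ) ≤ casLB (bLin (8 * n) (6 * n) n) p := by
  rcases casLB_of_cover' (cover_c12a hA hB hp2) (by rw [oddFlag_bH1lin n]; exact checkM_c12a) (by norm_num)
    (fun h => absurd h (by rw [dOf_h1]; omega)) with ⟨h0, -⟩ | h
  · rw [h0]; norm_num
  · linarith

/-- `(12.5,13]`: `casLB ≥ −7`. -/
theorem casLB_c12b (hA : 25 * n < 2 * p) (hB : 1 * p ≤ 13 * n) (hp2 : p % 2 = 1) :
    (-7 : ℤ) ≤ casLB (bLin (8 * n) (6 * n) n) p := by
  rcases casLB_of_cover' (cover_c12b hA hB hp2) (by rw [oddFlag_bH1lin n]; exact checkM_c12b) (by norm_num)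
    (fun h => absurd h (by rw [dOf_h1]; omega)) with ⟨h0, -⟩ | h
  · rw [h0]; norm_num
  · linarith

/-- `(13,14]`: `casLB ≥ −5`. -/
theorem casLB_c13 (hA : 13 * n < 1 * p) (hB : 1 * p ≤ 14 * n) (hp2 : p % 2 = 1) :
    (-5 : ℤ) ≤ casLB (bLin (8 * n) (6 * n) n) p := by
  rcases casLB_of_cover' (cover_c13 hA hB hp2) (by rw [oddFlag_bH1lin n]; exact checkM_c13) (by norm_num)
    (fun h => absurd h (by rw [dOf_h1]; omega)) with ⟨h0, -⟩ | h
  · rw [h0]; norm_num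
  · linarith

/-- `(14,15]` (the STAIR cell): `casLB ≥ −3`. -/
theorem casLB_c14 (hA : 14 * n < 1 * p) (hB : 1 * p ≤ 15 * n) (hp2 : p % 2 = 1) :
    (-3 : ℤ) ≤ casLB (bLin (8 * n) (6 * n) n) p := by
  rcases casLB_of_cover' (cover_c14 hA hB hp2) (by rw [oddFlag_bH1lin n]; exact checkM_c14) (by norm_num)
    (fun h => absurd h (by rw [dOf_h1]; omega)) with ⟨h0, -⟩ | h
  · rw [h0]; norm_num
  · linarith

/-- `(15,16]`: `casLB ≥ −1`. -/
theorem casLB_c15 (hA : 15 * n < 1 * p) (hB : 1 * p ≤ 16 * n) (hp2 : p % 2 = 1) :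
    (-1 : ℤ) ≤ casLB (bLin (8 * n) (6 * n) n) p := by
  rcases casLB_of_cover' (cover_c15 hA hB hp2) (by rw [oddFlag_bH1lin n]; exact checkM_c15) (by norm_num)
    (fun h => absurd h (by rw [dOf_h1]; omega)) with ⟨h0, -⟩ | h
  · rw [h0]; norm_num
  · linarith

/-- `(16,17]`: `casLB ≥ 0`. -/
theorem casLB_c16 (hA : 16 * n < 1 * p) (hB : 1 * p ≤ 17 * n) (hp2 : p % 2 = 1) :
    (0 : ℤ) ≤ casLB (bLin (8 * n) (6 * n) n) p := by
  rcases casLB_of_cover' (cover_c16 hA hB hp2) (by rw [oddFlag_bH1lin n]; exact checkM_c16) (by norm_num)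
    (fun h => absurd h (by rw [dOf_h1]; omega)) with ⟨h0, -⟩ | h
  · rw [h0]
  · linarith

/-- `(17,25]`: `casLB ≥ 1` (the class of `9n` — type `[−1, 1]` — has a pole, so the no-pole alternative is excluded). -/
theorem casLB_c17 (hA : 17 * n < 1 * p) (hB : 1 * p ≤ 25 * n) (hp2 : p % 2 = 1) :
    (1 : ℤ) ≤ casLB (bLin (8 * n) (6 * n) n) p := by
  rcases casLB_of_cover' (cover_c17 hA hB hp2) (by rw [oddFlag_bH1lin n]; exact checkM_c17) (by norm_num)
    (fun h => absurd h (by rw [dOf_h1]; omega)) with ⟨-, h0⟩ | h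
  · exfalso
    have ht := iv_c17_10 (n := n) (p := p) (x := 9 * n) hA hB (by omega) (by omega) (by omega) (by omega) (by omega) (by omega)
    have h1 := h0 (9 * n) (by omega)
    rw [ht.classPoleCount_eq] at h1
    revert h1; decide
  · linarith

/-- `(25,34]` (`p > d`): `casLB ≥ 0`. -/
theorem casLB_c25 (hA : 25 * n < 1 * p) (hB : 1 * p ≤ 34 * n) (hp2 : p % 2 = 1) :
    (0 : ℤ) ≤ casLB (bLin (8 * n) (6 * n) n) p := by
  rcases casLB_of_cover' (cover_c25 hA hB hp2) (by rw [oddFlag_bH1lin n]; exact checkM_c25) (by norm_num) (fun _ => le_rfl)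
    with ⟨h0, -⟩ | h
  · rw [h0]
  · linarith

end Cells

/-- Beyond the support (`p > 34n = b₀`) every class is at most the singleton `{x}`: a pole class is a tame single pole (`ν ≥ 0`), there is no
multipole class and `p > d`, so `casLB(b(n),p) ≥ 0` (the flag ray's `casLB_gt60`, verbatim for this ray). -/
theorem casLB_gt34 {n p : ℕ} (hp : 34 * n < p) : 0 ≤ casLB (bLin (8 * n) (6 * n) n) p := by
  have hsub : ∀ x, x < p → ∀ s ∈ classSet (bLin (8 * n) (6 * n) n) p x, s = x := by
    intro x hx s hs
    rw [mem_classSet_iff, AtlasRay4.b0_toNat] at hs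
    obtain ⟨hs34, k, hk⟩ := hs
    have hk0 : 0 ≤ k := by
      by_contra hneg
      push Not at hneg
      have : (p : ℤ) * k ≤ (p : ℤ) * (-1) := mul_le_mul_of_nonneg_left (by omega) (by omega)
      omega
    have hk1 : k < 1 := by
      by_contra hge
      push Not at hge
      have : (p : ℤ) * 1 ≤ (p : ℤ) * k := mul_le_mul_of_nonneg_left hge (by omega)
      omega
    interval_cases k
    omega
  have hle : ∀ x, x < p → classPoleCount (bLin (8 * n) (6 * n) n) p x ≤ 1 := by
    intro x hx
    unfold classPoleCount
    calc ((classSet (bLin (8 * n) (6 * n) n) p x).filter fun s => netExp (bLin (8 * n) (6 * n) n) s < 0).card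
        ≤ ({x} : Finset ℕ).card := card_le_card fun s hs => mem_singleton.2 (hsub x hx s (mem_filter.1 hs).1)
      _ = 1 := card_singleton x
  have hA : ∀ x, x < p → 1 ≤ classPoleCount (bLin (8 * n) (6 * n) n) p x →
      (0 : ℤ) ≤ classNu (bLin (8 * n) (6 * n) n) p x := by
    intro x hx h1
    have hc : classPoleCount (bLin (8 * n) (6 * n) n) p x = 1 := le_antisymm (hle x hx) h1
    obtain ⟨s, hs⟩ : ((classSet (bLin (8 * n) (6 * n) n) p x).filter
        fun s => netExp (bLin (8 * n) (6 * n) n) s < 0).Nonempty := by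
      rw [← card_pos]; unfold classPoleCount at h1; exact h1
    obtain ⟨hsx, hneg⟩ := mem_filter.1 hs
    obtain rfl := hsub x hx s hsx
    have htm : tameSingle (bLin (8 * n) (6 * n) n) p s = true := by
      rw [tameSingle_iff]; exact ⟨s, hsx, hneg, Or.inl hx⟩
    unfold classNu; rw [if_pos ⟨hc, htm⟩]; exact le_max_right _ _
  rcases casLB_ge_or_noPole (bLin (8 * n) (6 * n) n) p 0 0 hA (by norm_num)
      (fun x hx h2 => absurd (hle x hx) (by omega)) (fun _ => le_rfl) with ⟨h0, -⟩ | h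
  · rw [h0]
  · linarith

end Summit.KontsevichZagierPeriods.Zeta5Search.StairTS1
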